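/-
Copyright (c) 2026 The HCML crux team. All rights reserved.
Released under Apache 2.0 license as described in the file LICENSE.
Authors: K2E3-p23 (g5) (explicit-unit `hodgecm-mathlib-K2E3-p23-g5`)
-/
import Summits.HodgeConjecture.HodgeConjecture.Theorems.K2E3GL3FinConjAdmissible        -- ★ (B1⁰) p857656 (K2E3-p23 (g4)): `finConjGL_cc` on `Ḡ = GL₃(F) ⧸ Z`; brings ★ GL-P frame
import Summits.HodgeConjecture.HodgeConjecture.Theorems.K2E3GL3ModCocompactCentral       -- ★ (B0a) p857674 (K2E3-p23 (g4)): `G_Λ`, `q_Λ`, `isHaarMeasure_map_quotMap`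
import Summits.HodgeConjecture.HodgeConjecture.Theorems.K2E3GL3ModCocompactUnimodular    -- ★ (B0a-U) p857751 (K2E3-p23 (g5)): `G_Λ` unimodular (ED. 2, for ★ F2 at `G_Λ`)
import Mathlib.Topology.UrysohnsLemma
import HarnessLib

/-!
# (GL-[M6]-sc, B1) Finiteness of the conjugation-fibre integral on `G_Λ = GL₃(F) ⧸ Λ·1` — `finConjModCocompact_cc`

Cell `hodgecm-mathlib`, Track B, line `K2_E3_EllipticInputs`; payer «GL-[M6]-sc» of leaf (11-3-split-sc) (dealer K2E3-plan (g3) D63, line lead K2E3-p23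
(g4 → g5), RULINGS #1 (M1-2) brick B1).  For a closed cocompact `Λ ≤ F^×` put `G_Λ := GL₃(F) ⧸ Λ·1` (★ B0a) and let `q_Λ : G_Λ → Ḡ = GL₃(F) ⧸ Z` be the
projection (continuous, open, surjective, proper; `μ.map q_Λ` is a Haar measure of `Ḡ`, ★ B0a).  THE THEOREM: for a Haar measure `μ` on `G_Λ`, `C ⊆ G_Λ`
compact and `β : G_Λ → [0, Mb]` with compact `tsupport` (no continuity needed),

  **`∫⁻_{C ∩ {g : Z_{G_Λ}(g) compact}} ∫⁻_{G_Λ} β(x g x⁻¹) dμ(x) dμ(g) < ⊤`**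

— Harish-Chandra's finiteness ★ `finConjGL_cc` transported from `Ḡ` to `G_Λ` along `q_Λ`.  PROOF.  (§1) If `Z_{G_Λ}(g)` is compact then so is `Z_Ḡ(q_Λ g)`:
an element `ȳ = q_Λ y` centralising `q_Λ g` satisfies `g y = y g · (c·1)` for a scalar `c` with `c³ = 1` (determinant of the lifted commutator), and for each
of the finitely many cube roots of unity `c` the set `{y | g y = y g (c·1)}` is empty or a translate of `Z_{G_Λ}(g)`.  (§2, generic) along a measurable hom
`p : G → G'` the fibre integral of `β ≤ β' ∘ p` is at most the fibre integral of `β'` for `μ.map p`, and `∫⁻_{A} f ∘ p dμ ≤ ∫⁻_{B} f d(μ.map p)` when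
`A ⊆ p⁻¹(B)`.  (§3) Dominate `β ≤ β̄ ∘ q_Λ` with `β̄ := Mb · χ̄`, `χ̄` a Urysohn bump equal to `1` on `q_Λ(tsupport β)`; then
`C ∩ {Z_{G_Λ} compact} ⊆ q_Λ⁻¹(q_Λ(C) ∩ {Z_Ḡ compact})` by §1 and ★ `finConjGL_cc` for `(μ.map q_Λ, q_Λ(C), β̄)` bounds the right-hand side.

ED. 2 (K2E3-p23 (g5)): §4 **`finConjModCocompact`** — the same finiteness over the road-«FC» domain `C ∩ {g : ∫⁻ β(x g x⁻¹) dμ < ⊤}` (`β` continuous, `Λ`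
closed): on that domain the fibre integral equals `1_{Z compact} · fibre` (★ F2 `isCompact_centralizer_of_lintegral_conj_lt_top` at `G_Λ`, unimodular by ★ B0a-U),
and `∫⁻_C 1_{Zc} W ≤ ∫⁻_{C ∩ Zc} W` (`lintegral_indicator_le`, no measurability of `Zc`).  ED. 1 text byte-identical.

HONEST LABEL: HC_CM is proved only modulo the 7 printed citations (2 remaining named inputs: hLiu418 = stmt-HodgeConjecture-24832, h413 =
stmt-HodgeConjecture-24833) until rung 0 closes; count-neutral (kernel lane `--supports stmt-HodgeConjecture-24833 --as helper`), THEOREMS ONLY.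

References: Harish-Chandra (van Dijk) 1970, Part VII §2–§3 (finiteness of the fibre integral; the passage `G → G ⧸ Z`) [cite: HarishChandra1970, Part VII §3 p. 70];
Bourbaki–Weil, integration on quotients by compact normal subgroups [cite: WeilIntegration1965, §7]; Folland 1995 §2.6 [cite: Folland1995, §2.6].
-/

open MeasureTheory MeasureTheory.Measure Set Function Filter
open scoped NNReal ENNReal MatrixGroups Pointwise WithZero Valued Topology
open Matrix
open Literature.NumberTheory.Automorphic Literature.NumberTheory.GaloisRepresentations Literature.NumberTheory.GaloisRepresentations.IsNonarchimedeanLocalField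
open Summit.HodgeConjecture.HodgeConjecture.Cruxes.H413.K2E3GL3ModCentre Summit.HodgeConjecture.HodgeConjecture.Cruxes.H413.K2E3GL3ModCocompactCentral
open Summit.HodgeConjecture.HodgeConjecture.Cruxes.H413.K2E3GL3FinConjAdmissible

set_option linter.dupNamespace false

namespace Summit.HodgeConjecture.HodgeConjecture.Cruxes.H413.K2E3GL3FinConjModCocompact

/-! ## §1 Centralisers along `q_Λ : G_Λ → Ḡ` -/

section TwistedCommutant

variable {G : Type*} [Group G]

/-- If `g y₀ = y₀ g r` then `{y | g y = y g r} = Z(g) · y₀`. [folklore] -/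
theorem setOf_twistedComm_eq_image {g r y₀ : G} (h₀ : g * y₀ = y₀ * g * r) :
    {y : G | g * y = y * g * r} = (fun z => z * y₀) '' ((Subgroup.centralizer ({g} : Set G)) : Set G) := by
  have h1 : g * r = y₀⁻¹ * (g * y₀) := by rw [h₀, mul_assoc y₀ g r, inv_mul_cancel_left]
  ext y
  constructor
  · intro hy
    rw [mem_setOf_eq, mul_assoc y g r, h1] at hy
    refine ⟨y * y₀⁻¹, ?_, inv_mul_cancel_right y y₀⟩
    rw [SetLike.mem_coe, Subgroup.mem_centralizer_singleton_iff, ← mul_assoc g y, hy]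
    simp only [mul_assoc, mul_inv_cancel, mul_one]
  · rintro ⟨z, hz, rfl⟩
    rw [SetLike.mem_coe, Subgroup.mem_centralizer_singleton_iff] at hz
    show g * (z * y₀) = z * y₀ * g * r
    rw [← mul_assoc, ← hz, mul_assoc z, h₀, ← mul_assoc, ← mul_assoc]

/-- For `Z(g)` compact, each twisted commutant `{y | g y = y g r}` is compact (empty, or a translate of `Z(g)`). [folklore] -/
theorem isCompact_setOf_twistedComm [TopologicalSpace G] [ContinuousMul G] {g : G}
    (hZ : IsCompact ((Subgroup.centralizer ({g} : Set G)) : Set G)) (r : G) : IsCompact {y : G | g * y = y * g * r} := by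
  by_cases h : ∃ y₀, g * y₀ = y₀ * g * r
  · obtain ⟨y₀, h₀⟩ := h
    rw [setOf_twistedComm_eq_image h₀]
    exact hZ.image (continuous_id.mul continuous_const)
  · have he : {y : G | g * y = y * g * r} = ∅ := Set.eq_empty_of_forall_notMem fun y hy => h ⟨y, hy⟩
    rw [he]; exact isCompact_empty

end TwistedCommutant

section Algebra

variable {F : Type*} [Field F] (Λ₀ : Subgroup Fˣ) [(Λ₀.map (Matrix.GeneralLinearGroup.scalar (Fin 3))).Normal]
  (hle : Λ₀.map (Matrix.GeneralLinearGroup.scalar (Fin 3)) ≤ (Subgroup.center (GL (Fin 3) F)).comap (MonoidHom.id (GL (Fin 3) F)))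

/-- `det (c·1) = c³` in `GL₃`. [folklore] -/
theorem val_det_scalar (c : Fˣ) : ((Matrix.GeneralLinearGroup.det (Matrix.GeneralLinearGroup.scalar (Fin 3) c) : Fˣ) : F) = (c : F) ^ 3 := by
  rw [Matrix.GeneralLinearGroup.val_det_apply, Matrix.GeneralLinearGroup.coe_scalar, Matrix.scalar_apply, Matrix.det_diagonal, Finset.prod_const,
    Finset.card_univ, Fintype.card_fin]

/-- **If `q_Λ y` commutes with `q_Λ g` then `g y = y g (c·1)` for a cube root of unity `c`**: the lifted commutator is a scalar of determinant `1`.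
[cite: HarishChandra1970, Part VII §3 p. 70] -/
theorem exists_pow_three_eq_one_of_quotMap_commute {y g : GL (Fin 3) F ⧸ Λ₀.map (Matrix.GeneralLinearGroup.scalar (Fin 3))}
    (h : QuotientGroup.map _ (Subgroup.center (GL (Fin 3) F)) (MonoidHom.id (GL (Fin 3) F)) hle y *
        QuotientGroup.map _ (Subgroup.center (GL (Fin 3) F)) (MonoidHom.id (GL (Fin 3) F)) hle g =
      QuotientGroup.map _ (Subgroup.center (GL (Fin 3) F)) (MonoidHom.id (GL (Fin 3) F)) hle g *
        QuotientGroup.map _ (Subgroup.center (GL (Fin 3) F)) (MonoidHom.id (GL (Fin 3) F)) hle y) :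
    ∃ c : Fˣ, c ^ 3 = 1 ∧
      g * y = y * g * (QuotientGroup.mk (Matrix.GeneralLinearGroup.scalar (Fin 3) c) : GL (Fin 3) F ⧸ Λ₀.map (Matrix.GeneralLinearGroup.scalar (Fin 3))) := by
  obtain ⟨y', rfl⟩ := QuotientGroup.mk_surjective y
  obtain ⟨g', rfl⟩ := QuotientGroup.mk_surjective g
  rw [quotMap_mk Λ₀ hle, quotMap_mk Λ₀ hle, ← QuotientGroup.mk_mul, ← QuotientGroup.mk_mul] at h
  obtain ⟨c, hc⟩ := exists_scalar_of_mk_eq h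
  refine ⟨c, ?_, ?_⟩
  · have hdet := congrArg Matrix.GeneralLinearGroup.det hc
    rw [map_mul, map_mul, map_mul, mul_comm (Matrix.GeneralLinearGroup.det g') (Matrix.GeneralLinearGroup.det y')] at hdet
    have h1 : Matrix.GeneralLinearGroup.det y' * Matrix.GeneralLinearGroup.det g' * Matrix.GeneralLinearGroup.det (Matrix.GeneralLinearGroup.scalar (Fin 3) c) =
        Matrix.GeneralLinearGroup.det y' * Matrix.GeneralLinearGroup.det g' * 1 := by rw [mul_one]; exact hdet.symm
    have h2 := mul_left_cancel h1
    refine Units.ext ?_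
    rw [Units.val_pow_eq_pow_val, ← val_det_scalar, h2, Units.val_one]
  · rw [← QuotientGroup.mk_mul, ← QuotientGroup.mk_mul, ← QuotientGroup.mk_mul, hc]

/-- `q_Λ⁻¹(Z_Ḡ(q_Λ g)) ⊆ ⋃_{c³ = 1} {y | g y = y g (c·1)}`. [cite: HarishChandra1970, Part VII §3 p. 70] -/
theorem preimage_centralizer_quotMap_subset (g : GL (Fin 3) F ⧸ Λ₀.map (Matrix.GeneralLinearGroup.scalar (Fin 3))) :
    (QuotientGroup.map _ (Subgroup.center (GL (Fin 3) F)) (MonoidHom.id (GL (Fin 3) F)) hle) ⁻¹'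
        ((Subgroup.centralizer ({QuotientGroup.map _ (Subgroup.center (GL (Fin 3) F)) (MonoidHom.id (GL (Fin 3) F)) hle g} :
          Set (GL (Fin 3) F ⧸ Subgroup.center (GL (Fin 3) F)))) : Set (GL (Fin 3) F ⧸ Subgroup.center (GL (Fin 3) F))) ⊆
      ⋃ c ∈ {c : Fˣ | c ^ 3 = 1}, {y : GL (Fin 3) F ⧸ Λ₀.map (Matrix.GeneralLinearGroup.scalar (Fin 3)) |
        g * y = y * g * (QuotientGroup.mk (Matrix.GeneralLinearGroup.scalar (Fin 3) c) : GL (Fin 3) F ⧸ Λ₀.map (Matrix.GeneralLinearGroup.scalar (Fin 3)))} := by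
  intro y hy
  rw [Set.mem_preimage, SetLike.mem_coe, Subgroup.mem_centralizer_singleton_iff] at hy
  obtain ⟨c, hc3, hc⟩ := exists_pow_three_eq_one_of_quotMap_commute Λ₀ hle hy
  exact Set.mem_biUnion hc3 hc

/-- The cube roots of unity of a field form a finite set. [folklore] -/
theorem finite_setOf_pow_three_eq_one : ({c : Fˣ | c ^ 3 = 1} : Set Fˣ).Finite := by
  have h : ({c : Fˣ | c ^ 3 = 1} : Set Fˣ) = ((rootsOfUnity 3 F : Subgroup Fˣ) : Set Fˣ) := by
    ext c; rw [mem_setOf_eq, SetLike.mem_coe, mem_rootsOfUnity]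
  rw [h]
  exact Set.finite_coe_iff.1 (inferInstanceAs (Finite (rootsOfUnity 3 F)))

end Algebra

section Topology

variable {F : Type*} [Field F] [ValuativeRel F] [TopologicalSpace F] [IsNonarchimedeanLocalField F]
  (Λ₀ : Subgroup Fˣ) [(Λ₀.map (Matrix.GeneralLinearGroup.scalar (Fin 3))).Normal]
  (hle : Λ₀.map (Matrix.GeneralLinearGroup.scalar (Fin 3)) ≤ (Subgroup.center (GL (Fin 3) F)).comap (MonoidHom.id (GL (Fin 3) F)))

/-- **CENTRALISER COMPARISON along `q_Λ`**: if `Z_{G_Λ}(g)` is compact then `Z_Ḡ(q_Λ g)` is compact — it is closed and contained in the image of the finite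
union of the compact twisted commutants `{y | g y = y g (c·1)}`, `c³ = 1`. [cite: HarishChandra1970, Part VII §3 p. 70] -/
theorem isCompact_centralizer_quotMap (g : GL (Fin 3) F ⧸ Λ₀.map (Matrix.GeneralLinearGroup.scalar (Fin 3)))
    (hg : IsCompact ((Subgroup.centralizer ({g} : Set (GL (Fin 3) F ⧸ Λ₀.map (Matrix.GeneralLinearGroup.scalar (Fin 3))))) :
      Set (GL (Fin 3) F ⧸ Λ₀.map (Matrix.GeneralLinearGroup.scalar (Fin 3))))) :
    IsCompact ((Subgroup.centralizer ({QuotientGroup.map _ (Subgroup.center (GL (Fin 3) F)) (MonoidHom.id (GL (Fin 3) F)) hle g} :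
      Set (GL (Fin 3) F ⧸ Subgroup.center (GL (Fin 3) F)))) : Set (GL (Fin 3) F ⧸ Subgroup.center (GL (Fin 3) F))) := by
  haveI : T2Space (GL (Fin 3) F ⧸ Subgroup.center (GL (Fin 3) F)) := t2Space_quot F
  have hS : IsCompact (⋃ c ∈ {c : Fˣ | c ^ 3 = 1}, {y : GL (Fin 3) F ⧸ Λ₀.map (Matrix.GeneralLinearGroup.scalar (Fin 3)) |
      g * y = y * g * (QuotientGroup.mk (Matrix.GeneralLinearGroup.scalar (Fin 3) c) : GL (Fin 3) F ⧸ Λ₀.map (Matrix.GeneralLinearGroup.scalar (Fin 3)))}) :=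
    finite_setOf_pow_three_eq_one.isCompact_biUnion fun c _ => isCompact_setOf_twistedComm hg _
  have hcl : IsClosed ((Subgroup.centralizer ({QuotientGroup.map _ (Subgroup.center (GL (Fin 3) F)) (MonoidHom.id (GL (Fin 3) F)) hle g} :
      Set (GL (Fin 3) F ⧸ Subgroup.center (GL (Fin 3) F)))) : Set (GL (Fin 3) F ⧸ Subgroup.center (GL (Fin 3) F))) := by
    have heq : ((Subgroup.centralizer ({QuotientGroup.map _ (Subgroup.center (GL (Fin 3) F)) (MonoidHom.id (GL (Fin 3) F)) hle g} :
        Set (GL (Fin 3) F ⧸ Subgroup.center (GL (Fin 3) F)))) : Set (GL (Fin 3) F ⧸ Subgroup.center (GL (Fin 3) F))) =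
        {k | k * QuotientGroup.map _ (Subgroup.center (GL (Fin 3) F)) (MonoidHom.id (GL (Fin 3) F)) hle g =
          QuotientGroup.map _ (Subgroup.center (GL (Fin 3) F)) (MonoidHom.id (GL (Fin 3) F)) hle g * k} :=
      Set.ext fun k => Subgroup.mem_centralizer_singleton_iff
    rw [heq]
    exact isClosed_eq (continuous_id.mul continuous_const) (continuous_const.mul continuous_id)
  refine (hS.image (continuous_quotMap Λ₀ hle)).of_isClosed_subset hcl ?_
  intro k hk
  obtain ⟨y, rfl⟩ := surjective_quotMap Λ₀ hle k
  exact ⟨y, preimage_centralizer_quotMap_subset Λ₀ hle g hk, rfl⟩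

end Topology

/-! ## §2 Generic transfer of fibre integrals along a measurable hom -/

section Transfer

/-- Along a measurable hom `p : G → G'` with `β ≤ β' ∘ p`: `∫⁻ β(x g x⁻¹) dμ(x) ≤ ∫⁻ β'(x' (p g) x'⁻¹) d(μ.map p)(x')`. [cite: Folland1995, §2.6] -/
theorem lintegral_conj_le_lintegral_conj_map {G G' : Type*} [Group G] [Group G'] [MeasurableSpace G] [MeasurableSpace G']
    [TopologicalSpace G'] [IsTopologicalGroup G'] [BorelSpace G'] (p : G →* G') (hp : Measurable p) (μ : Measure G)
    {β : G → ℝ≥0∞} {β' : G' → ℝ≥0∞} (hβ' : Continuous β') (hdom : ∀ y, β y ≤ β' (p y)) (g : G) :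
    ∫⁻ x, β (x * g * x⁻¹) ∂μ ≤ ∫⁻ x', β' (x' * p g * x'⁻¹) ∂(μ.map p) := by
  have hm : Measurable fun x' : G' => β' (x' * p g * x'⁻¹) := (hβ'.comp ((continuous_id.mul continuous_const).mul continuous_id.inv)).measurable
  calc ∫⁻ x, β (x * g * x⁻¹) ∂μ ≤ ∫⁻ x, β' (p x * p g * (p x)⁻¹) ∂μ := lintegral_mono fun x => (hdom _).trans_eq (by rw [map_mul, map_mul, map_inv])
    _ = ∫⁻ x', β' (x' * p g * x'⁻¹) ∂(μ.map p) := (lintegral_map hm hp).symm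

/-- For `A ⊆ p⁻¹(B)` and measurable `f`, `p`: `∫⁻_{A} f ∘ p dμ ≤ ∫⁻_{B} f d(μ.map p)` (no measurability of `A`, `B` needed). [cite: Folland1995, §2.6] -/
theorem setLIntegral_comp_le_setLIntegral_map {α γ : Type*} [MeasurableSpace α] [MeasurableSpace γ] (μ : Measure α)
    {p : α → γ} (hp : Measurable p) {f : γ → ℝ≥0∞} (hf : Measurable f) {A : Set α} {B : Set γ} (hAB : A ⊆ p ⁻¹' B) :
    ∫⁻ a in A, f (p a) ∂μ ≤ ∫⁻ b in B, f b ∂(μ.map p) := by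
  have hle : (μ.restrict (p ⁻¹' B)).map p ≤ (μ.map p).restrict B := by
    refine Measure.le_iff.2 fun t ht => ?_
    rw [Measure.map_apply hp ht, Measure.restrict_apply (hp ht), Measure.restrict_apply ht, ← Set.preimage_inter]
    exact le_map_apply hp.aemeasurable _
  calc ∫⁻ a in A, f (p a) ∂μ ≤ ∫⁻ a in p ⁻¹' B, f (p a) ∂μ := lintegral_mono_set hAB
    _ = ∫⁻ b, f b ∂((μ.restrict (p ⁻¹' B)).map p) := (lintegral_map hf hp).symm
    _ ≤ ∫⁻ b in B, f b ∂(μ.map p) := lintegral_mono' hle le_rfl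

/-- The conjugation-fibre integral `g ↦ ∫⁻ β'(x g x⁻¹) dν(x)` of a continuous `β'` is Borel (Tonelli measurability). [cite: Folland1995, §2.4] -/
theorem measurable_lintegral_conj {G' : Type*} [Group G'] [TopologicalSpace G'] [IsTopologicalGroup G'] [SecondCountableTopology G']
    [MeasurableSpace G'] [BorelSpace G'] (ν : Measure G') [SFinite ν] {β' : G' → ℝ≥0∞} (hβ' : Continuous β') :
    Measurable fun g : G' => ∫⁻ x, β' (x * g * x⁻¹) ∂ν :=
  Measurable.lintegral_prod_right (f := fun g x : G' => β' (x * g * x⁻¹)) (hβ'.comp ((continuous_snd.mul continuous_fst).mul continuous_snd.inv)).measurable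

end Transfer

/-! ## §3 `finConjModCocompact_cc` -/

section Main

/-- **(GL-[M6]-sc, B1) FINITENESS OF THE CONJUGATION-FIBRE INTEGRAL ON `G_Λ = GL₃(F) ⧸ Λ·1`, COMPACT-CENTRALISER DOMAIN.**  `F` a non-archimedean local field of
characteristic `0` with uniformizer `ϖ`, `Λ ≤ F^×` with `F^× ⧸ Λ` compact, `μ` a Haar measure on `G_Λ`, `C ⊆ G_Λ` compact, `β : G_Λ → [0, Mb]` continuous
with compact support (`Mb < ∞`; continuity of `β` is NOT needed — only the domination `β ≤ Mb · 1_{tsupport β}` is used):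
`∫⁻_{C ∩ {g : Z_{G_Λ}(g) compact}} ∫⁻ β(x g x⁻¹) dμ(x) dμ(g) < ⊤` — ★ `finConjGL_cc` transported along `q_Λ` (§1 centraliser comparison, §2 change of variables,
Urysohn domination `β ≤ Mb·χ̄ ∘ q_Λ`). [cite: HarishChandra1970, Part VII §3 p. 70] [cite: WeilIntegration1965, §7] -/
theorem finConjModCocompact_cc {F : Type*} [Field F] [Valued F ℤᵐ⁰] [ValuativeRel F] [(Valued.v : Valuation F ℤᵐ⁰).Compatible] [IsNonarchimedeanLocalField F]
    [CharZero F] {ϖ : F} (hϖ : Valued.v ϖ = WithZero.exp (-1 : ℤ))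
    (Λ₀ : Subgroup Fˣ) [(Λ₀.map (Matrix.GeneralLinearGroup.scalar (Fin 3))).Normal] [CompactSpace (Fˣ ⧸ Λ₀)]
    [MeasurableSpace (GL (Fin 3) F ⧸ Λ₀.map (Matrix.GeneralLinearGroup.scalar (Fin 3)))] [BorelSpace (GL (Fin 3) F ⧸ Λ₀.map (Matrix.GeneralLinearGroup.scalar (Fin 3)))]
    (μ : Measure (GL (Fin 3) F ⧸ Λ₀.map (Matrix.GeneralLinearGroup.scalar (Fin 3)))) [μ.IsHaarMeasure]
    {C : Set (GL (Fin 3) F ⧸ Λ₀.map (Matrix.GeneralLinearGroup.scalar (Fin 3)))} (hC : IsCompact C)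
    {β : (GL (Fin 3) F ⧸ Λ₀.map (Matrix.GeneralLinearGroup.scalar (Fin 3))) → ℝ≥0∞} (hβs : IsCompact (tsupport β))
    {Mb : ℝ≥0∞} (hMb : Mb ≠ ⊤) (hβM : ∀ g, β g ≤ Mb) :
    ∫⁻ g in C ∩ {h : GL (Fin 3) F ⧸ Λ₀.map (Matrix.GeneralLinearGroup.scalar (Fin 3)) |
        IsCompact ((Subgroup.centralizer ({h} : Set (GL (Fin 3) F ⧸ Λ₀.map (Matrix.GeneralLinearGroup.scalar (Fin 3))))) :
          Set (GL (Fin 3) F ⧸ Λ₀.map (Matrix.GeneralLinearGroup.scalar (Fin 3))))},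
      ∫⁻ x, β (x * g * x⁻¹) ∂μ ∂μ < ⊤ := by
  -- §0 frame: `GL₃(F)`, `Ḡ`, the projection `q := q_Λ`, the Haar measure `μ̄ := μ.map q`
  haveI : SecondCountableTopology (GL (Fin 3) F) := secondCountableTopology_gl3 F
  haveI : LocallyCompactSpace (GL (Fin 3) F) := locallyCompactSpace_gl3 F
  haveI : T2Space (GL (Fin 3) F ⧸ Subgroup.center (GL (Fin 3) F)) := t2Space_quot F
  haveI : SigmaCompactSpace (GL (Fin 3) F ⧸ Subgroup.center (GL (Fin 3) F)) := sigmaCompactSpace_of_locallyCompact_secondCountable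
  letI : MeasurableSpace (GL (Fin 3) F ⧸ Subgroup.center (GL (Fin 3) F)) := borel _
  haveI : BorelSpace (GL (Fin 3) F ⧸ Subgroup.center (GL (Fin 3) F)) := ⟨rfl⟩
  have hle : Λ₀.map (Matrix.GeneralLinearGroup.scalar (Fin 3)) ≤ (Subgroup.center (GL (Fin 3) F)).comap (MonoidHom.id (GL (Fin 3) F)) :=
    map_scalar_le_comap_center Λ₀
  set q : GL (Fin 3) F ⧸ Λ₀.map (Matrix.GeneralLinearGroup.scalar (Fin 3)) →* GL (Fin 3) F ⧸ Subgroup.center (GL (Fin 3) F) :=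
    QuotientGroup.map _ (Subgroup.center (GL (Fin 3) F)) (MonoidHom.id (GL (Fin 3) F)) hle with hq
  have hqc : Continuous q := continuous_quotMap Λ₀ hle
  have hqm : Measurable q := hqc.measurable
  haveI : (μ.map q).IsHaarMeasure := isHaarMeasure_map_quotMap Λ₀ hle μ
  -- §1 the dominating bump `β̄ = Mb · χ̄` on `Ḡ`, `χ̄ = 1` on `q(tsupport β)`
  obtain ⟨χ, hχ1, -, hχcs, hχ01⟩ := exists_continuous_one_zero_of_isCompact (hβs.image hqc) isClosed_empty (Set.disjoint_empty _)
  obtain ⟨βb, hβb⟩ : ∃ βb : (GL (Fin 3) F ⧸ Subgroup.center (GL (Fin 3) F)) → ℝ≥0∞, ∀ y, βb y = ENNReal.ofReal (Mb.toReal * χ y) := ⟨_, fun _ => rfl⟩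
  have hβbf : βb = fun y => ENNReal.ofReal (Mb.toReal * χ y) := funext hβb
  have hβbc : Continuous βb := by rw [hβbf]; exact ENNReal.continuous_ofReal.comp (continuous_const.mul χ.continuous)
  have hβbs : IsCompact (tsupport βb) := by
    rw [hβbf]
    exact ((hχcs.mul_left (f := fun _ => Mb.toReal)).comp_left ENNReal.ofReal_zero).isCompact
  have hβbM : ∀ y, βb y ≤ Mb := fun y => by
    rw [hβb]
    calc ENNReal.ofReal (Mb.toReal * χ y) ≤ ENNReal.ofReal Mb.toReal :=
          ENNReal.ofReal_le_ofReal (mul_le_of_le_one_right ENNReal.toReal_nonneg (hχ01 y).2)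
      _ = Mb := ENNReal.ofReal_toReal hMb
  have hdom : ∀ y, β y ≤ βb (q y) := fun y => by
    by_cases hy : y ∈ tsupport β
    · have h1 : χ (q y) = 1 := hχ1 (Set.mem_image_of_mem q hy)
      rw [hβb, h1, mul_one, ENNReal.ofReal_toReal hMb]
      exact hβM y
    · rw [image_eq_zero_of_notMem_tsupport hy]; exact bot_le
  -- §2 fibre comparison and the domain inclusion (§1 centraliser comparison)
  have hW : ∀ g, ∫⁻ x, β (x * g * x⁻¹) ∂μ ≤ ∫⁻ x', βb (x' * q g * x'⁻¹) ∂(μ.map q) := fun g =>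
    lintegral_conj_le_lintegral_conj_map q hqm μ hβbc hdom g
  have hWm : Measurable fun g' : GL (Fin 3) F ⧸ Subgroup.center (GL (Fin 3) F) => ∫⁻ x', βb (x' * g' * x'⁻¹) ∂(μ.map q) :=
    measurable_lintegral_conj (μ.map q) hβbc
  have hsub : C ∩ {h : GL (Fin 3) F ⧸ Λ₀.map (Matrix.GeneralLinearGroup.scalar (Fin 3)) |
      IsCompact ((Subgroup.centralizer ({h} : Set (GL (Fin 3) F ⧸ Λ₀.map (Matrix.GeneralLinearGroup.scalar (Fin 3))))) :
        Set (GL (Fin 3) F ⧸ Λ₀.map (Matrix.GeneralLinearGroup.scalar (Fin 3))))} ⊆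
      q ⁻¹' (q '' C ∩ {h : GL (Fin 3) F ⧸ Subgroup.center (GL (Fin 3) F) |
        IsCompact ((Subgroup.centralizer ({h} : Set (GL (Fin 3) F ⧸ Subgroup.center (GL (Fin 3) F)))) : Set (GL (Fin 3) F ⧸ Subgroup.center (GL (Fin 3) F)))}) :=
    fun g hg => ⟨Set.mem_image_of_mem q hg.1, isCompact_centralizer_quotMap Λ₀ hle g hg.2⟩
  -- §3 ★ `finConjGL_cc` on `Ḡ`
  calc ∫⁻ g in C ∩ {h : GL (Fin 3) F ⧸ Λ₀.map (Matrix.GeneralLinearGroup.scalar (Fin 3)) |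
          IsCompact ((Subgroup.centralizer ({h} : Set (GL (Fin 3) F ⧸ Λ₀.map (Matrix.GeneralLinearGroup.scalar (Fin 3))))) :
            Set (GL (Fin 3) F ⧸ Λ₀.map (Matrix.GeneralLinearGroup.scalar (Fin 3))))}, ∫⁻ x, β (x * g * x⁻¹) ∂μ ∂μ
      ≤ ∫⁻ g in C ∩ {h : GL (Fin 3) F ⧸ Λ₀.map (Matrix.GeneralLinearGroup.scalar (Fin 3)) |
          IsCompact ((Subgroup.centralizer ({h} : Set (GL (Fin 3) F ⧸ Λ₀.map (Matrix.GeneralLinearGroup.scalar (Fin 3))))) :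
            Set (GL (Fin 3) F ⧸ Λ₀.map (Matrix.GeneralLinearGroup.scalar (Fin 3))))}, ∫⁻ x', βb (x' * q g * x'⁻¹) ∂(μ.map q) ∂μ :=
        lintegral_mono fun g => hW g
    _ ≤ ∫⁻ g' in q '' C ∩ {h : GL (Fin 3) F ⧸ Subgroup.center (GL (Fin 3) F) |
          IsCompact ((Subgroup.centralizer ({h} : Set (GL (Fin 3) F ⧸ Subgroup.center (GL (Fin 3) F)))) : Set (GL (Fin 3) F ⧸ Subgroup.center (GL (Fin 3) F)))},
          ∫⁻ x', βb (x' * g' * x'⁻¹) ∂(μ.map q) ∂(μ.map q) :=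
        setLIntegral_comp_le_setLIntegral_map μ hqm hWm hsub
    _ < ⊤ := finConjGL_cc hϖ (μ.map q) (hC.image hqc) hβbc hβbs hMb hβbM

end Main

/-! ## §4 (ED. 2) The road-«FC» domain `C ∩ {fibre < ⊤}` — `finConjModCocompact` -/

section Phi

/-- **(GL-[M6]-sc, B1-Φ) FINITENESS OF THE CONJUGATION-FIBRE INTEGRAL ON `G_Λ`, ROAD-«FC» DOMAIN** (`Λ ≤ F^×` closed with `F^× ⧸ Λ` compact, `β : G_Λ → [0, Mb]`
continuous with compact support): `∫⁻_{C ∩ {g : ∫⁻ β(xgx⁻¹) dμ < ⊤}} ∫⁻ β(x g x⁻¹) dμ(x) dμ(g) < ⊤` — the shape of ★ `finConj` ∕ ★ `finConjGL` consumed by the (FC-9)-type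
payers.  On the domain, `W(g) ≠ 0` forces `β(x g x⁻¹) ≠ 0` for some `x`, hence `Z_{G_Λ}(g)` compact (★ F2, `G_Λ` unimodular ★ B0a-U); so `W ≤ 1_{Zc}·W` there and
`∫⁻_C 1_{Zc} W ≤ ∫⁻_{C ∩ Zc} W < ⊤` (★ B1 `finConjModCocompact_cc`). [cite: HarishChandra1970, Part VII §3 p. 70] [cite: Folland1995, §2.6] -/
theorem finConjModCocompact {F : Type*} [Field F] [Valued F ℤᵐ⁰] [ValuativeRel F] [(Valued.v : Valuation F ℤᵐ⁰).Compatible] [IsNonarchimedeanLocalField F]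
    [CharZero F] {ϖ : F} (hϖ : Valued.v ϖ = WithZero.exp (-1 : ℤ))
    (Λ₀ : Subgroup Fˣ) [(Λ₀.map (Matrix.GeneralLinearGroup.scalar (Fin 3))).Normal] (hΛ : IsClosed (Λ₀ : Set Fˣ)) [CompactSpace (Fˣ ⧸ Λ₀)]
    [MeasurableSpace (GL (Fin 3) F ⧸ Λ₀.map (Matrix.GeneralLinearGroup.scalar (Fin 3)))] [BorelSpace (GL (Fin 3) F ⧸ Λ₀.map (Matrix.GeneralLinearGroup.scalar (Fin 3)))]
    (μ : Measure (GL (Fin 3) F ⧸ Λ₀.map (Matrix.GeneralLinearGroup.scalar (Fin 3)))) [μ.IsHaarMeasure]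
    {C : Set (GL (Fin 3) F ⧸ Λ₀.map (Matrix.GeneralLinearGroup.scalar (Fin 3)))} (hC : IsCompact C)
    {β : (GL (Fin 3) F ⧸ Λ₀.map (Matrix.GeneralLinearGroup.scalar (Fin 3))) → ℝ≥0∞} (hβ : Continuous β) (hβs : IsCompact (tsupport β))
    {Mb : ℝ≥0∞} (hMb : Mb ≠ ⊤) (hβM : ∀ g, β g ≤ Mb) :
    ∫⁻ g in C ∩ {g : GL (Fin 3) F ⧸ Λ₀.map (Matrix.GeneralLinearGroup.scalar (Fin 3)) | ∫⁻ x, β (x * g * x⁻¹) ∂μ < ⊤}, ∫⁻ x, β (x * g * x⁻¹) ∂μ ∂μ < ⊤ := by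
  -- §0 frame: `G_Λ` Hausdorff, second countable, locally compact, σ-compact, unimodular
  haveI : SecondCountableTopology (GL (Fin 3) F) := secondCountableTopology_gl3 F
  haveI : LocallyCompactSpace (GL (Fin 3) F) := locallyCompactSpace_gl3 F
  haveI : T2Space (GL (Fin 3) F ⧸ Λ₀.map (Matrix.GeneralLinearGroup.scalar (Fin 3))) := t2Space_quotScalar Λ₀ hΛ
  haveI : SigmaCompactSpace (GL (Fin 3) F ⧸ Λ₀.map (Matrix.GeneralLinearGroup.scalar (Fin 3))) := sigmaCompactSpace_of_locallyCompact_secondCountable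
  haveI : μ.IsMulRightInvariant := K2E3GL3ModCocompactUnimodular.isMulRightInvariant_quotScalar_of_isHaarMeasure Λ₀ hΛ hϖ μ
  set Zc : Set (GL (Fin 3) F ⧸ Λ₀.map (Matrix.GeneralLinearGroup.scalar (Fin 3))) :=
    {h | IsCompact ((Subgroup.centralizer ({h} : Set (GL (Fin 3) F ⧸ Λ₀.map (Matrix.GeneralLinearGroup.scalar (Fin 3))))) :
      Set (GL (Fin 3) F ⧸ Λ₀.map (Matrix.GeneralLinearGroup.scalar (Fin 3))))} with hZc
  -- §1 the domain is measurable; on it `W ≤ 1_{Zc} · W` (★ F2)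
  have hWm : Measurable fun g : GL (Fin 3) F ⧸ Λ₀.map (Matrix.GeneralLinearGroup.scalar (Fin 3)) => ∫⁻ x, β (x * g * x⁻¹) ∂μ :=
    measurable_lintegral_conj μ hβ
  have hAm : MeasurableSet (C ∩ {g : GL (Fin 3) F ⧸ Λ₀.map (Matrix.GeneralLinearGroup.scalar (Fin 3)) | ∫⁻ x, β (x * g * x⁻¹) ∂μ < ⊤}) :=
    hC.isClosed.measurableSet.inter (measurableSet_lt hWm measurable_const)
  have hpt : ∀ g ∈ C ∩ {g : GL (Fin 3) F ⧸ Λ₀.map (Matrix.GeneralLinearGroup.scalar (Fin 3)) | ∫⁻ x, β (x * g * x⁻¹) ∂μ < ⊤},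
      ∫⁻ x, β (x * g * x⁻¹) ∂μ ≤ Zc.indicator (fun g => ∫⁻ x, β (x * g * x⁻¹) ∂μ) g := by
    intro g hg
    by_cases hex : ∃ x, β (x * g * x⁻¹) ≠ 0
    · obtain ⟨x, hx⟩ := hex
      have hgZ : g ∈ Zc := K2E3FinConjFibreReduction.isCompact_centralizer_of_lintegral_conj_lt_top μ hβ hg.2 hx
      rw [Set.indicator_of_mem hgZ]
    · push Not at hex
      have h0 : ∫⁻ x, β (x * g * x⁻¹) ∂μ = 0 := by simp [hex]
      rw [h0]; exact bot_le
  -- §2 `∫⁻_{C ∩ Φ} W ≤ ∫⁻_C 1_{Zc} W ≤ ∫⁻_{C ∩ Zc} W < ⊤` (★ B1)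
  calc ∫⁻ g in C ∩ {g : GL (Fin 3) F ⧸ Λ₀.map (Matrix.GeneralLinearGroup.scalar (Fin 3)) | ∫⁻ x, β (x * g * x⁻¹) ∂μ < ⊤}, ∫⁻ x, β (x * g * x⁻¹) ∂μ ∂μ
      ≤ ∫⁻ g in C ∩ {g : GL (Fin 3) F ⧸ Λ₀.map (Matrix.GeneralLinearGroup.scalar (Fin 3)) | ∫⁻ x, β (x * g * x⁻¹) ∂μ < ⊤},
          Zc.indicator (fun g => ∫⁻ x, β (x * g * x⁻¹) ∂μ) g ∂μ := lintegral_mono_ae (ae_restrict_of_forall_mem hAm hpt)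
    _ ≤ ∫⁻ g in C, Zc.indicator (fun g => ∫⁻ x, β (x * g * x⁻¹) ∂μ) g ∂μ := lintegral_mono_set Set.inter_subset_left
    _ ≤ ∫⁻ g in Zc, ∫⁻ x, β (x * g * x⁻¹) ∂μ ∂(μ.restrict C) := lintegral_indicator_le _ _
    _ = ∫⁻ g in C ∩ Zc, ∫⁻ x, β (x * g * x⁻¹) ∂μ ∂μ := by rw [Measure.restrict_restrict' hC.isClosed.measurableSet, Set.inter_comm]
    _ < ⊤ := finConjModCocompact_cc hϖ Λ₀ μ hC hβs hMb hβM

end Phi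

end Summit.HodgeConjecture.HodgeConjecture.Cruxes.H413.K2E3GL3FinConjModCocompact
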